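import Mathlib
import HarnessLib
import Summits.Ventures.LatticeQCDFlow.Scoring.ReplicaError
import Summits.Ventures.LatticeQCDFlow.Scoring.Thinning

/-!
# The batch-means error bar in expectation: `E[SE²_BM] = Var(x̄) − (2σ²/(b(a−1))) (τ_{ab} − τ_b)`
# exactly, and `|τ_{ab} − τ_b| ≤ M (r/(b(1−r)²) + r^{b+1}/(1−r))` under a geometric envelope

HONEST FRAMING: exact (Metropolis-corrected) sampling algorithms for lattice gauge theory;
figures of merit are autocorrelation/cost numbers at stated couplings and volumes; no
continuum-physics claim.

Venture `LatticeQCDFlow` (cell pub-lqcd), topic `Scoring`; FANOUT row 8 (`s0-cpn-nemc`, GEN-14).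
NEW WORK of the cell, not a published result; no definition is introduced (row 11's
`Scoring.replicaMean` / `Scoring.replicaSEsq` / `Scoring.tauIntN` are reused: with the `a` batch
means `B_j = (1/b) Σ_{i<b} X_{bj+i}` as "replicas", `replicaSEsq B a = Σ_j (B_j − x̄)²/(a(a−1))` IS
the batch-means estimator of `Var(x̄)`, `x̄` the mean of all `N = a b` samples).  The row's files
certify the TRUE error of a time average; the number a run PRINTS is an ESTIMATE of it, and the
cell's invariants ask for "effective sample size honesty".  This file is the population statement
behind the batch-means error bar for any square-integrable weakly stationary window (equal means,
lag-only covariances `σ² ρ(|i − j|)`) — second-moment algebra over Mathlib's `variance` /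
`covariance`, row 11's `variance_mean_range_of_cov_eq` (`Var(mean of n) = 2 τ_n σ²/n`) and
`integral_sum_sq_sub_replicaMean` (which needs NO uncorrelatedness).  Printed counterpart NAMED
ONLY: the consistency / bias analysis of non-overlapping batch means (Schmeiser 1982; Glynn–Whitt
1991; Flegal–Jones 2010, *Batch means and spectral variance estimators in MCMC*, Ann. Statist. 38),
nothing cited as a fact.

## Content (`X_0, …, X_{ab−1}` square integrable, `E X_n = m`, `Cov(X_n, X_{n'}) = σ² ρ(|n − n'|)`,
## `ρ(0) = 1`; `a ≥ 2` batches of length `b ≥ 1`; `τ_n = Scoring.tauIntN ρ n`)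

* `replicaMean_batch_eq` — the grand mean of the batch means is the full mean;
  `variance_batchMean_eq` — every batch mean has variance `2 τ_b σ²/b`; `integral_batchMean_eq`;
* **`integral_batchSEsq_eq`** — THE IDENTITY:
  `E[SE²_BM] = Var(x̄_{ab}) − (2σ²/(b(a−1))) (τ_{ab} − τ_b)` with `Var(x̄_{ab}) = 2 τ_{ab} σ²/(ab)`:
  the batch-means error bar is biased by exactly the growth of the finite-size integrated
  autocorrelation time between the batch length and the run length;
* `tauIntN_mono_of_nonneg` — `ρ ≥ 0` ⇒ `n ↦ τ_n` is monotone, so then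
  **`integral_batchSEsq_le_variance`** — `E[SE²_BM] ≤ Var(x̄)`: for positively autocorrelated
  samplers the batch-means error bar is ANTI-conservative in expectation, never conservative;
* `sum_range_succ_mul_pow_le`, `abs_tauIntN_sub_tauIntN_le` — under a geometric envelope
  `|ρ(t)| ≤ M r^t` (`t ≥ 1`, `0 ≤ r < 1`), for `1 ≤ b ≤ n`:
  `|τ_n − τ_b| ≤ M (r/(b(1−r)²) + r^{b+1}/(1−r))`; hence
  **`abs_integral_batchSEsq_sub_variance_le`** —
  `|E[SE²_BM] − Var(x̄)| ≤ (2σ²/(b(a−1))) M (r/(b(1−r)²) + r^{b+1}/(1−r))`, i.e. relative to the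
  iid-level `σ²/(ab)` a bias `O(a M/((a−1) b (1−r)²))`: honest once `b ≫ 1/(1−r)²`.

The simulated-chain instance (stationary Markov chain with a Doeblin certificate, `r = 1 − ε`,
`M = 1`; nonnegative autocovariances for positive kernels such as the exact flow sampler) is
`Scoring/ChainBatchMeans.lean`.  NOT CLAIMED: the sampling distribution of `SE²_BM` (its own
scatter, `χ²`-type with `a − 1` degrees of freedom only under a Gaussian model); overlapping batch
means / the Γ-method window rule; any number of ours.
-/

noncomputable section

namespace Summit.Ventures.LatticeQCDFlow.Scoring

open MeasureTheory ProbabilityTheory Filter Finset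
open scoped BigOperators

/-! ### Finite-size integrated autocorrelation times at two lengths -/

section Tau

/-- `ρ ≥ 0` ⇒ `τ_n(ρ) ≤ τ_{n'}(ρ)` for `n ≤ n'` (Fejér weights grow with the length and the added
lags enter with nonnegative weight). -/
theorem tauIntN_mono_of_nonneg {ρ : ℕ → ℝ} (hρ : ∀ t, 0 ≤ ρ t) {n n' : ℕ} (hn : n ≠ 0)
    (hnn' : n ≤ n') : tauIntN ρ n ≤ tauIntN ρ n' := by
  unfold tauIntN
  have hn0 : (0 : ℝ) < n := by exact_mod_cast Nat.pos_of_ne_zero hn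
  have hn'0 : (0 : ℝ) < n' := by exact_mod_cast lt_of_lt_of_le (Nat.pos_of_ne_zero hn) hnn'
  have hle : (n : ℝ) ≤ n' := by exact_mod_cast hnn'
  have h1 : ∑ t ∈ range n, (1 - ((t : ℝ) + 1) / n) * ρ (t + 1)
      ≤ ∑ t ∈ range n, (1 - ((t : ℝ) + 1) / n') * ρ (t + 1) := by
    refine Finset.sum_le_sum fun t _ => mul_le_mul_of_nonneg_right ?_ (hρ _)
    have : ((t : ℝ) + 1) / n' ≤ ((t : ℝ) + 1) / n :=
      div_le_div_of_nonneg_left (by positivity) hn0 hle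
    linarith
  have h2 : ∑ t ∈ range n, (1 - ((t : ℝ) + 1) / n') * ρ (t + 1)
      ≤ ∑ t ∈ range n', (1 - ((t : ℝ) + 1) / n') * ρ (t + 1) := by
    refine Finset.sum_le_sum_of_subset_of_nonneg (Finset.range_mono hnn') fun t ht _ => ?_
    refine mul_nonneg ?_ (hρ _)
    have ht' : (t : ℝ) + 1 ≤ n' := by exact_mod_cast Nat.succ_le_of_lt (mem_range.1 ht)
    rw [sub_nonneg, div_le_one hn'0]
    exact ht'
  linarith

/-- `Σ_{t<b} (t+1) r^{t+1} ≤ r/(1 − r)²` for `0 ≤ r < 1`. -/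
theorem sum_range_succ_mul_pow_le {r : ℝ} (hr0 : 0 ≤ r) (hr1 : r < 1) (b : ℕ) :
    ∑ t ∈ range b, ((t : ℝ) + 1) * r ^ (t + 1) ≤ r / (1 - r) ^ 2 := by
  have hnorm : ‖r‖ < 1 := by rw [Real.norm_eq_abs, abs_of_nonneg hr0]; exact hr1
  have hs := hasSum_coe_mul_geometric_of_norm_lt_one hnorm
  have heq : ∑ t ∈ range b, ((t : ℝ) + 1) * r ^ (t + 1) = ∑ n ∈ range (b + 1), (n : ℝ) * r ^ n := by
    rw [Finset.sum_range_succ']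
    simp
  rw [heq]
  exact sum_le_hasSum (range (b + 1)) (fun n _ => mul_nonneg n.cast_nonneg (pow_nonneg hr0 n)) hs

/-- **Two lengths under a geometric envelope**: if `|ρ(t)| ≤ M r^t` for `t ≥ 1` (`0 ≤ M`,
`0 ≤ r < 1`) then for `1 ≤ b ≤ n`: `|τ_n − τ_b| ≤ M (r/(b(1−r)²) + r^{b+1}/(1−r))` — the Fejér
correction inside the short window plus the tail beyond it. -/
theorem abs_tauIntN_sub_tauIntN_le {ρ : ℕ → ℝ} {M r : ℝ} (hM : 0 ≤ M) (hr0 : 0 ≤ r) (hr1 : r < 1)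
    (hρ : ∀ t, 1 ≤ t → |ρ t| ≤ M * r ^ t) {b n : ℕ} (hb : b ≠ 0) (hbn : b ≤ n) :
    |tauIntN ρ n - tauIntN ρ b| ≤ M * (r / (b * (1 - r) ^ 2) + r ^ (b + 1) / (1 - r)) := by
  have hb0 : (0 : ℝ) < b := by exact_mod_cast Nat.pos_of_ne_zero hb
  have hn0 : (0 : ℝ) < n := by exact_mod_cast lt_of_lt_of_le (Nat.pos_of_ne_zero hb) hbn
  have hbn' : (b : ℝ) ≤ n := by exact_mod_cast hbn
  have h1r : 0 < 1 - r := by linarith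
  set w : ℕ → ℕ → ℝ := fun N t => 1 - ((t : ℝ) + 1) / N with hw
  -- split the long window at `b`
  have hsplit : ∑ t ∈ range n, w n t * ρ (t + 1)
      = ∑ t ∈ range b, w n t * ρ (t + 1) + ∑ t ∈ Ico b n, w n t * ρ (t + 1) := by
    rw [Finset.range_eq_Ico, ← Finset.sum_Ico_consecutive _ (Nat.zero_le b) hbn, Finset.range_eq_Ico]
  have hdiff : tauIntN ρ n - tauIntN ρ b
      = ∑ t ∈ range b, (w n t - w b t) * ρ (t + 1) + ∑ t ∈ Ico b n, w n t * ρ (t + 1) := by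
    unfold tauIntN
    rw [show ∑ t ∈ range n, (1 - ((t : ℝ) + 1) / n) * ρ (t + 1) = ∑ t ∈ range n, w n t * ρ (t + 1)
        from rfl, show ∑ t ∈ range b, (1 - ((t : ℝ) + 1) / b) * ρ (t + 1)
        = ∑ t ∈ range b, w b t * ρ (t + 1) from rfl, hsplit]
    simp only [sub_mul, Finset.sum_sub_distrib]
    ring
  -- first piece: the Fejér correction inside the short window
  have hA : |∑ t ∈ range b, (w n t - w b t) * ρ (t + 1)| ≤ M * (r / (b * (1 - r) ^ 2)) := by
    calc |∑ t ∈ range b, (w n t - w b t) * ρ (t + 1)|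
        ≤ ∑ t ∈ range b, |(w n t - w b t) * ρ (t + 1)| := Finset.abs_sum_le_sum_abs _ _
      _ ≤ ∑ t ∈ range b, ((t : ℝ) + 1) / b * (M * r ^ (t + 1)) := by
          refine Finset.sum_le_sum fun t _ => ?_
          rw [abs_mul]
          refine mul_le_mul ?_ (hρ (t + 1) (Nat.succ_le_succ (Nat.zero_le _))) (abs_nonneg _)
            (by positivity)
          have hwd : w n t - w b t = ((t : ℝ) + 1) * (1 / b - 1 / n) := by
            simp only [hw]; ring
          rw [hwd, abs_of_nonneg (mul_nonneg (by positivity)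
            (sub_nonneg.2 (div_le_div_of_nonneg_left zero_le_one hb0 hbn')))]
          have : (1 : ℝ) / b - 1 / n ≤ 1 / b := by
            have := div_nonneg zero_le_one hn0.le; linarith
          calc ((t : ℝ) + 1) * (1 / b - 1 / n) ≤ ((t : ℝ) + 1) * (1 / b) :=
                mul_le_mul_of_nonneg_left this (by positivity)
            _ = ((t : ℝ) + 1) / b := by ring
      _ = M / b * ∑ t ∈ range b, ((t : ℝ) + 1) * r ^ (t + 1) := by
          rw [Finset.mul_sum]; refine Finset.sum_congr rfl fun t _ => ?_; ring
      _ ≤ M / b * (r / (1 - r) ^ 2) :=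
          mul_le_mul_of_nonneg_left (sum_range_succ_mul_pow_le hr0 hr1 b) (div_nonneg hM hb0.le)
      _ = M * (r / (b * (1 - r) ^ 2)) := by
          field_simp
  -- second piece: the tail beyond the short window
  have hB : |∑ t ∈ Ico b n, w n t * ρ (t + 1)| ≤ M * (r ^ (b + 1) / (1 - r)) := by
    calc |∑ t ∈ Ico b n, w n t * ρ (t + 1)|
        ≤ ∑ t ∈ Ico b n, |w n t * ρ (t + 1)| := Finset.abs_sum_le_sum_abs _ _
      _ ≤ ∑ t ∈ Ico b n, M * r ^ (t + 1) := by
          refine Finset.sum_le_sum fun t ht => ?_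
          rw [abs_mul]
          have htn : (t : ℝ) + 1 ≤ n := by exact_mod_cast Nat.succ_le_of_lt (Finset.mem_Ico.1 ht).2
          have hw0 : 0 ≤ w n t := by
            simp only [hw]; rw [sub_nonneg, div_le_one hn0]; exact htn
          have hw1 : w n t ≤ 1 := by
            simp only [hw]
            have : 0 ≤ ((t : ℝ) + 1) / n := by positivity
            linarith
          calc |w n t| * |ρ (t + 1)| ≤ 1 * (M * r ^ (t + 1)) :=
                mul_le_mul (by rw [abs_of_nonneg hw0]; exact hw1)
                  (hρ (t + 1) (Nat.succ_le_succ (Nat.zero_le _))) (abs_nonneg _) zero_le_one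
            _ = M * r ^ (t + 1) := one_mul _
      _ = M * r ^ (b + 1) * ∑ u ∈ range (n - b), r ^ u := by
          rw [Finset.sum_Ico_eq_sum_range, Finset.mul_sum]
          refine Finset.sum_congr rfl fun u _ => ?_
          rw [show b + u + 1 = (b + 1) + u by ring, pow_add]; ring
      _ ≤ M * r ^ (b + 1) * (1 - r)⁻¹ :=
          mul_le_mul_of_nonneg_left (sum_le_hasSum (range (n - b)) (fun u _ => pow_nonneg hr0 u)
            (hasSum_geometric_of_lt_one hr0 hr1)) (mul_nonneg hM (pow_nonneg hr0 _))
      _ = M * (r ^ (b + 1) / (1 - r)) := by rw [div_eq_mul_inv, mul_assoc]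
  rw [hdiff]
  calc |∑ t ∈ range b, (w n t - w b t) * ρ (t + 1) + ∑ t ∈ Ico b n, w n t * ρ (t + 1)|
      ≤ |∑ t ∈ range b, (w n t - w b t) * ρ (t + 1)| + |∑ t ∈ Ico b n, w n t * ρ (t + 1)| :=
        abs_add_le _ _
    _ ≤ M * (r / (b * (1 - r) ^ 2)) + M * (r ^ (b + 1) / (1 - r)) := add_le_add hA hB
    _ = M * (r / (b * (1 - r) ^ 2) + r ^ (b + 1) / (1 - r)) := by ring

end Tau

/-! ### Batch means of a weakly stationary window -/

section Population

variable {Ω' : Type*} {mΩ' : MeasurableSpace Ω'} {μ : Measure Ω'} [IsProbabilityMeasure μ]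
variable {X : ℕ → Ω' → ℝ} {a b : ℕ}

omit [IsProbabilityMeasure μ] in
/-- The grand mean of the `a` batch means of length `b` is the mean of all `b a` samples. -/
theorem replicaMean_batch_eq (ω : Ω') :
    replicaMean (fun j ω => (∑ i ∈ range b, X (b * j + i) ω) / b) a ω
      = (∑ n ∈ range (b * a), X n ω) / ((b * a : ℕ) : ℝ) := by
  unfold replicaMean
  rw [sum_range_mul_eq_sum_sum (fun n => X n ω) b a, ← Finset.sum_div, div_div, Nat.cast_mul]

omit [IsProbabilityMeasure μ] in
/-- Batch means of square-integrable samples are square integrable. -/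
theorem memLp_batchMean (hX : ∀ n < b * a, MemLp (X n) 2 μ) {j : ℕ} (hj : j < a) :
    MemLp (fun ω => (∑ i ∈ range b, X (b * j + i) ω) / b) 2 μ := by
  have hidx : ∀ i < b, b * j + i < b * a := fun i hi => by
    have : b * j + b ≤ b * a := by rw [← Nat.mul_succ]; exact Nat.mul_le_mul_left b hj
    omega
  exact memLp_div_const
    (memLp_finsetSum (range b) fun i hi => hX (b * j + i) (hidx i (mem_range.1 hi))) _

/-- Every batch mean has the common mean `m`. -/
theorem integral_batchMean_eq (hb : b ≠ 0) (hX : ∀ n < b * a, MemLp (X n) 2 μ) {m : ℝ}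
    (hmean : ∀ n < b * a, μ[X n] = m) {j : ℕ} (hj : j < a) :
    μ[fun ω => (∑ i ∈ range b, X (b * j + i) ω) / b] = m := by
  have hidx : ∀ i < b, b * j + i < b * a := fun i hi => by
    have : b * j + b ≤ b * a := by rw [← Nat.mul_succ]; exact Nat.mul_le_mul_left b hj
    omega
  have hb' : (b : ℝ) ≠ 0 := by exact_mod_cast hb
  show ∫ ω, (∑ i ∈ range b, X (b * j + i) ω) / b ∂μ = m
  rw [integral_div, integral_finsetSum _ (fun i hi =>
    (hX _ (hidx i (mem_range.1 hi))).integrable one_le_two)]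
  rw [Finset.sum_congr rfl fun i hi => hmean _ (hidx i (mem_range.1 hi)), Finset.sum_const,
    Finset.card_range, nsmul_eq_mul]
  field_simp

/-- **Every batch mean has variance `2 τ_b σ²/b`** under lag-only covariances on the window. -/
theorem variance_batchMean_eq (hb : b ≠ 0) (hX : ∀ n < b * a, MemLp (X n) 2 μ) (σ2 : ℝ)
    (ρ : ℕ → ℝ) (hρ : ρ 0 = 1)
    (hC : ∀ n < b * a, ∀ n' < b * a, cov[X n, X n'; μ] = σ2 * ρ (Nat.dist n n')) {j : ℕ}
    (hj : j < a) :
    Var[fun ω => (∑ i ∈ range b, X (b * j + i) ω) / b; μ] = 2 * tauIntN ρ b * σ2 / b := by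
  have hidx : ∀ i < b, b * j + i < b * a := fun i hi => by
    have : b * j + b ≤ b * a := by rw [← Nat.mul_succ]; exact Nat.mul_le_mul_left b hj
    omega
  exact variance_mean_range_of_cov_eq (fun i => X (b * j + i)) σ2 ρ hρ hb
    (fun i hi => hX _ (hidx i hi)) fun i hi i' hi' => by
      rw [hC _ (hidx i hi) _ (hidx i' hi'), Nat.dist_add_add_left]

/-- **THE BATCH-MEANS IDENTITY.**  For a square-integrable window `X_0, …, X_{ab−1}` with equal
means and lag-only covariances `σ² ρ(|n − n'|)` (`ρ 0 = 1`), `a ≥ 2` batches of length `b ≥ 1`: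
`E[SE²_BM] = Var(x̄_{ab}) − (2σ²/(b(a−1))) · (τ_{ab} − τ_b)`, where
`SE²_BM = Σ_{j<a} (B_j − x̄)²/(a(a−1))` is the batch-means estimator of `Var(x̄_{ab})`. -/
theorem integral_batchSEsq_eq (ha : 2 ≤ a) (hb : b ≠ 0) (hX : ∀ n < b * a, MemLp (X n) 2 μ)
    (σ2 : ℝ) (ρ : ℕ → ℝ) (hρ : ρ 0 = 1)
    (hC : ∀ n < b * a, ∀ n' < b * a, cov[X n, X n'; μ] = σ2 * ρ (Nat.dist n n'))
    {m : ℝ} (hmean : ∀ n < b * a, μ[X n] = m) :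
    μ[replicaSEsq (fun j ω => (∑ i ∈ range b, X (b * j + i) ω) / b) a]
      = Var[fun ω => (∑ n ∈ range (b * a), X n ω) / ((b * a : ℕ) : ℝ); μ]
        - 2 * σ2 / (b * (a - 1)) * (tauIntN ρ (b * a) - tauIntN ρ b) := by
  have ha0 : a ≠ 0 := by omega
  have hba : b * a ≠ 0 := Nat.mul_ne_zero hb ha0
  have ha' : (2 : ℝ) ≤ a := by exact_mod_cast ha
  have hane : (a : ℝ) ≠ 0 := by positivity
  have ha1 : (a : ℝ) - 1 ≠ 0 := by linarith
  have hb' : (b : ℝ) ≠ 0 := by exact_mod_cast hb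
  set B : ℕ → Ω' → ℝ := fun j ω => (∑ i ∈ range b, X (b * j + i) ω) / b with hB
  have hB2 : ∀ j < a, MemLp (B j) 2 μ := fun j hj => memLp_batchMean hX hj
  -- the grand mean of the batch means is the full mean
  have hgrand : replicaMean B a = fun ω => (∑ n ∈ range (b * a), X n ω) / ((b * a : ℕ) : ℝ) :=
    funext fun ω => replicaMean_batch_eq ω
  have hVfull : Var[replicaMean B a; μ] = 2 * tauIntN ρ (b * a) * σ2 / ((b * a : ℕ) : ℝ) := by
    rw [hgrand]
    exact variance_mean_range_of_cov_eq X σ2 ρ hρ hba hX hC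
  have hVbatch : ∀ j ∈ range a, Var[B j; μ] = 2 * tauIntN ρ b * σ2 / b := fun j hj =>
    variance_batchMean_eq hb hX σ2 ρ hρ hC (mem_range.1 hj)
  have hmeanB : ∀ j ∈ range a, μ[B j] = m := fun j hj =>
    integral_batchMean_eq hb hX hmean (mem_range.1 hj)
  -- expectation of the between-batch sum of squares (no uncorrelatedness needed)
  unfold replicaSEsq
  rw [integral_div, integral_sum_sq_sub_replicaMean ha0 hB2]
  have hspread : ∑ r ∈ range a, (μ[B r] - (∑ s ∈ range a, μ[B s]) / (a : ℝ)) ^ 2 = 0 := by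
    refine Finset.sum_eq_zero fun r hr => ?_
    rw [hmeanB r hr, Finset.sum_congr rfl hmeanB, Finset.sum_const, Finset.card_range,
      nsmul_eq_mul, mul_div_cancel_left₀ m hane, sub_self]
    ring
  rw [hspread, add_zero, Finset.sum_congr rfl hVbatch, Finset.sum_const, Finset.card_range,
    nsmul_eq_mul, ← hgrand, hVfull, Nat.cast_mul]
  field_simp
  ring

/-- **Anti-conservative for positive autocorrelations**: if moreover `ρ ≥ 0` and `σ² ≥ 0` then
`E[SE²_BM] ≤ Var(x̄_{ab})` — the batch-means error bar never over-covers in expectation. -/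
theorem integral_batchSEsq_le_variance (ha : 2 ≤ a) (hb : b ≠ 0)
    (hX : ∀ n < b * a, MemLp (X n) 2 μ) {σ2 : ℝ} (hσ : 0 ≤ σ2) {ρ : ℕ → ℝ} (hρ : ρ 0 = 1)
    (hρ0 : ∀ t, 0 ≤ ρ t)
    (hC : ∀ n < b * a, ∀ n' < b * a, cov[X n, X n'; μ] = σ2 * ρ (Nat.dist n n'))
    {m : ℝ} (hmean : ∀ n < b * a, μ[X n] = m) :
    μ[replicaSEsq (fun j ω => (∑ i ∈ range b, X (b * j + i) ω) / b) a]
      ≤ Var[fun ω => (∑ n ∈ range (b * a), X n ω) / ((b * a : ℕ) : ℝ); μ] := by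
  rw [integral_batchSEsq_eq ha hb hX σ2 ρ hρ hC hmean]
  have ha' : (2 : ℝ) ≤ a := by exact_mod_cast ha
  have hb0 : (0 : ℝ) < b := by exact_mod_cast Nat.pos_of_ne_zero hb
  have hba : b ≤ b * a := Nat.le_mul_of_pos_right b (by omega)
  have hτ : tauIntN ρ b ≤ tauIntN ρ (b * a) := tauIntN_mono_of_nonneg hρ0 hb hba
  have hcoef : 0 ≤ 2 * σ2 / (b * (a - 1)) := div_nonneg (by linarith) (by nlinarith)
  nlinarith [mul_nonneg hcoef (sub_nonneg.2 hτ)]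

/-- **CERTIFIED BIAS OF THE BATCH-MEANS ERROR BAR.**  If moreover `|ρ(t)| ≤ M r^t` for `t ≥ 1`
(`0 ≤ M`, `0 ≤ r < 1`, `σ² ≥ 0`), then
`|E[SE²_BM] − Var(x̄_{ab})| ≤ (2σ²/(b(a−1))) · M (r/(b(1−r)²) + r^{b+1}/(1−r))`. -/
theorem abs_integral_batchSEsq_sub_variance_le (ha : 2 ≤ a) (hb : b ≠ 0)
    (hX : ∀ n < b * a, MemLp (X n) 2 μ) {σ2 : ℝ} (hσ : 0 ≤ σ2) {ρ : ℕ → ℝ} (hρ : ρ 0 = 1)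
    {M r : ℝ} (hM : 0 ≤ M) (hr0 : 0 ≤ r) (hr1 : r < 1) (hρM : ∀ t, 1 ≤ t → |ρ t| ≤ M * r ^ t)
    (hC : ∀ n < b * a, ∀ n' < b * a, cov[X n, X n'; μ] = σ2 * ρ (Nat.dist n n'))
    {m : ℝ} (hmean : ∀ n < b * a, μ[X n] = m) :
    |μ[replicaSEsq (fun j ω => (∑ i ∈ range b, X (b * j + i) ω) / b) a]
        - Var[fun ω => (∑ n ∈ range (b * a), X n ω) / ((b * a : ℕ) : ℝ); μ]|
      ≤ 2 * σ2 / (b * (a - 1)) * (M * (r / (b * (1 - r) ^ 2) + r ^ (b + 1) / (1 - r))) := by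
  rw [integral_batchSEsq_eq ha hb hX σ2 ρ hρ hC hmean]
  have ha' : (2 : ℝ) ≤ a := by exact_mod_cast ha
  have hb0 : (0 : ℝ) < b := by exact_mod_cast Nat.pos_of_ne_zero hb
  have hcoef : 0 ≤ 2 * σ2 / (b * (a - 1)) := div_nonneg (by linarith) (by nlinarith)
  have hba : b ≤ b * a := Nat.le_mul_of_pos_right b (by omega)
  have hτ := abs_tauIntN_sub_tauIntN_le hM hr0 hr1 hρM hb hba
  rw [show ∀ V c : ℝ, V - c - V = -c from fun V c => by ring, abs_neg, abs_mul,
    abs_of_nonneg hcoef]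
  exact mul_le_mul_of_nonneg_left hτ hcoef

end Population

end Summit.Ventures.LatticeQCDFlow.Scoring

end
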